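import Summits.QuantumFields.YangMills.Theorems.UnitScaleTiltHalvingP1FlatCoreTopBondDictionary
import Summits.QuantumFields.YangMills.Theorems.UnitScaleTiltProp8ChartLocalityFlat
import Summits.QuantumFields.YangMills.Theorems.UnitScaleTiltProp8ChartDoubleBarLogSecondOrder
import Summits.QuantumFields.YangMills.Theorems.UnitScaleTiltHalvingP1FlatCoreTopCombRemainderLoc
import Literature.MathematicalPhysics.QuantumFieldTheory.Balaban1983to89.B9Ineq3137LocalSup
import Literature.MathematicalPhysics.QuantumFieldTheory.Balaban1983to89.B8Eq156KLevelLocal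
import HarnessLib

/-!
# Line H (`BirthV10.stub_halvingStep`, stmt-QuantumFields-19200), row (P3-top-b) — **THE LINEAR KNIT**: the comb restriction functional
# `Q_k(1, iηA′)` of [Balaban1985RegularSpaces] (1.42) at a TOP constraint bond is the torus double-bar top variable `log U̿^{(k)}` up to the two
# second-order remainders, because the two LINEAR parts coincide under the cover

Cell `ym3-torus` (HUMAN RULING D-0037: YM₃ on T³ is ladder rung R3, NOT the Clay problem), width seat `ym-ust-19936-w8` gen 2; LEAD-H RULING L-9 («LINEAR»).
`--supports stmt-QuantumFields-19200 --as helper`; THEOREMS ONLY (0 `def`, 0 `sorry`); count-neutral; nothing here claims `core′`, the stub, the crux or the gap.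

THE ROUTE (LEAD-H ★w5-19200 g4 RULING L-9, 2026-08-28).  Prop. 3 of [Balaban1985RegularSpaces] consumes, at the top level `j = k` of its `k`-th step, the
smallness `|Q_k(1, iηA′)(c)| < 2dLα₁` of the COMB (corner-based, `ℤᵈ`) composed covariant average of the small exponent field `A′` ((1.42), hypothesis `H42` of
✓`B8Prop3GaugeFixedKLevel.hP3_gaugeFixed_of_b9`).  What the H-line's (o)-normalisation delivers is a statement about the TORUS (symmetrised, centred) double-bar
average: `log U̿^{(k)}(W♭)(c♭)` is within `2|c♭₋ − y₀|₁ε₁` of `0` (✓`P1FlatCoreDP1TopBonds.norm_mlog_dbarIterU_chart_le_of_top`, row (L4)).  The two nonlinear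
averages differ, but their LINEAR parts are the same plain bond-block mean: `linCovIter L 1 B k = Lᵏ·Q_k(B♭)` under the cover (✓`P1FlatCoreTopBondDictionary`, row (L3)),
and each side is its linear part up to `O((Lᵏηs)²)` — comb: [Balaban1985Averaging] Prop. 4 (row (L1), ★w2-19936 g8), torus: the weighted-ball quadratic remainder of the
chart (row (L2), ★w6-19200 g2).  THIS FILE is the junction itself, with the two remainders as displayed numbers `R₁`, `R₂` (v1.0), so that rows (L1)/(L2) plug in BY NAME:
* §1 dictionary — `shift_cover`, `shift_coverAt`, `tgt_mk_cover`, `tgt_mk_coverAt`, `reads_of_bondIn` (a bond of the comb box `B^k(c₋) ∪ B^k(c₊)` covers a bond of the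
  torus read territory of `c♭ = ⟨π_k z, κ⟩`), `segSum_const_smul`, `bondAvgIter_const_smul`, `norm_iEta_le_of_junction` (the comb box bound from the torus read bound);
* §2 ★★ `norm_logCovIter_one_le_of_remainders` — `‖Q_k(1, iηA′)(z,κ)‖ ≤ ‖log U̿^{(k)}(W♭)(c♭)‖ + R₁ + R₂` whenever `A′ = A♭∘π` on the comb box, `W♭ = e^{iηA♭}` on the
  read territory, `‖Q_k(1,iηA′) − linCovIter‖ ≤ R₁` and `‖(−i)log U̿^{(k)}(e^{iηA♭})(c♭) − ηLᵏ·Q_k(A♭)(c♭)‖ ≤ R₂`;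
* §3 (v1.1) ★★★ `norm_logCovIter_one_le_norm_mlog_dbarIterU` — §2 with the two remainders SUPPLIED BY NAME at `Matrix n n ℂ` (L²-operator norm):
  `R₁ = C2 d·(Lᵏηs)²` (row (L1), ✓`P1FlatCoreTopCombRemainderLoc.norm_logCovIter_sub_linCovIter_le_loc`, ★w2-19936 g8) and `R₂ = 64·60800·((d+2)L)²·(Lᵏηs)²`
  (row (L2), ✓`Prop8ChartDoubleBar.norm_chartLogAt_sub_smul_bondAvgIter_le_of_reads`, ★w6-19200 g2), from the single read bound `‖A♭‖ ≤ s`;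
  `…_of_socket` — the same in the socket letters `‖A♭‖ ≤ α₂·(Lᵏη)⁻¹` of `H42`; `logCovIter_top_lt_of_window` — `< 2dLα₁` from the (o)-bound
  `‖log U̿^{(k)}(W♭)(c♭)‖ ≤ 2ϱε₁` (row (L4), ✓`P1FlatCoreDP1TopBonds.norm_mlog_dbarIterU_chart_le_of_top`, LEAD-H) under the displayed window `hwin`.
HONEST SCOPE.  Triangle inequalities over landed identities (✓`linCovIter_one_eq_smul_bondAvgIter`, ✓`B9Ineq3137LocalSup.linCovIter_congr`,
✓`Prop8ChartDoubleBar.dbarIterU_congr_of_agree`); the two remainder ESTIMATES are inputs here, supplied by rows (L1)/(L2); the window that turns the bound into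
`< 2dLα₁` is the assembler's.  Nothing of Props. 3/4 is proved in this file.

References: T. Bałaban, CMP **99** (1985) 75–102 [Balaban1985RegularSpaces] ((1.42) p.83, (1.56) p.86); CMP **98** (1985) 17–51 [Balaban1985Averaging]
((125)–(127) pp.36–37, Prop. 4 p.38, p.24); CMP **102** (1985) 277–309 [Balaban1985Variational] ((152)–(156) pp.301–302); CMP **95** (1984) 17–40
[Balaban1984PropagatorsI] ((1.18) p.20); CMP **116** (1988) [Balaban1987RG1] ((0.1) p.251).
-/

set_option autoImplicit false

noncomputable section

open scoped BigOperators

namespace Summit.QuantumFields.YangMills.Theorems.P1FlatCoreTopLinearKnit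

open Literature.MathematicalPhysics.QuantumFieldTheory.Balaban1983to89
open T4Continuum MatrixLog
open B15Eq112TorusCover (cover cover_apply)
open B14DomainGeom (Pt)
open Node00 (coverAt iterBlockOf_cover)
open LatticeFieldCalculus (bondAvgIter segSum)
open B5Eq118OneStroke (iterBlockOf bondAvgIter_eq_blockSum)
open B7Prop1Explicit (e e_apply)
open B7Prop1Local (InBox AgreeOn loK bondHiK)
open B7Prop5Flat (BondIn)
open B7Prop4GeneralLevels (logCovIter linCovIter)
open B8Eq146AExpansion (iEta)
open B8Eq156KLevelLocal (blockMap_of_inBox_loK)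
open B9Ineq3137LocalSup (linCovIter_congr)
open Summit.QuantumFields.YangMills.Theorems.Prop8Chart (expCfg)
open Summit.QuantumFields.YangMills.Theorems.Prop8ChartDoubleBar (dbarIterU dbarIterU_congr_of_agree)
open Summit.QuantumFields.YangMills.Theorems.P1FlatCoreTopBondDictionary (linCovIter_one_eq_smul_bondAvgIter)

variable {P : Params}

/-! ## §1 Dictionary: shifted covered sites, the read territory over the comb box, `ℂ`-homogeneity of `Q_k` -/

section Dictionary

/-- `π(w) + e_μ = π(w + e_μ)` on the fine torus. [cite: Balaban1987RG1, (0.1) p.251] -/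
theorem shift_cover (w : Pt P.d) (μ : Fin P.d) : (cover P w).shift μ = cover P (w + e μ) := by
  funext ν
  simp only [Site.shift, Function.update_apply, cover_apply, Pi.add_apply, e_apply]
  by_cases h : ν = μ
  · subst h; simp
  · simp [h]

/-- `π_j(z) + e_κ = π_j(z + e_κ)` on the `j`-th torus. [cite: Balaban1987RG1, (0.1) p.251] -/
theorem shift_coverAt (j : ℕ) (z : Pt P.d) (κ : Fin P.d) : (coverAt P j z).shift κ = coverAt P j (z + e κ) := by
  funext ν
  simp only [Site.shift, Function.update_apply, coverAt, Pi.add_apply, e_apply]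
  by_cases h : ν = κ
  · subst h; simp
  · simp [h]

/-- The covered bond `⟨π w, μ⟩` ends at `π(w + e_μ)`. [cite: Balaban1984PropagatorsI, (1.7) p.18] -/
theorem tgt_mk_cover (w : Pt P.d) (μ : Fin P.d) : (⟨cover P w, μ⟩ : PBond P 0).tgt = cover P (w + e μ) :=
  shift_cover w μ

/-- The top bond `c♭ = ⟨π_j z, κ⟩` ends at `π_j(z + e_κ)`. [cite: Balaban1984PropagatorsI, (1.18) p.20] -/
theorem tgt_mk_coverAt (j : ℕ) (z : Pt P.d) (κ : Fin P.d) : (⟨coverAt P j z, κ⟩ : PBond P j).tgt = coverAt P j (z + e κ) :=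
  shift_coverAt j z κ

/-- **THE COMB BOX COVERS THE TORUS READ TERRITORY.**  A fine bond `⟨w, w + e_μ⟩` of the box `B^k(c₋) ∪ B^k(c₊) = [Lᵏz, Lᵏz + (Lᵏ−1)𝟙 + Lᵏe_κ]`
([Balaban1985Averaging] p.24) covers a torus bond both of whose `k`-blocks are among the two ends of `c♭ = ⟨π_k z, κ⟩` — the read set of `U̿^{(k)}(c♭)`
(✓`B8Eq156KLevelLocal.blockMap_of_inBox_loK` + ✓`Node00.iterBlockOf_cover`). [cite: Balaban1985Averaging, p.24 (after (43)); Balaban1985RegularSpaces, (1.5) p.77] -/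
theorem reads_of_bondIn {k : ℕ} (hk : k ≤ P.m + P.K) (z : Pt P.d) (κ : Fin P.d) {w : Pt P.d} {μ : Fin P.d}
    (hw : BondIn (loK P.L k z) (bondHiK P.L k z κ) w μ) :
    (iterBlockOf k (⟨cover P w, μ⟩ : PBond P 0).src = (⟨coverAt P k z, κ⟩ : PBond P k).src ∨
        iterBlockOf k (⟨cover P w, μ⟩ : PBond P 0).src = (⟨coverAt P k z, κ⟩ : PBond P k).tgt) ∧
      (iterBlockOf k (⟨cover P w, μ⟩ : PBond P 0).tgt = (⟨coverAt P k z, κ⟩ : PBond P k).src ∨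
        iterBlockOf k (⟨cover P w, μ⟩ : PBond P 0).tgt = (⟨coverAt P k z, κ⟩ : PBond P k).tgt) := by
  have hL : 1 ≤ P.L := P.L_pos
  have key : ∀ x : Pt P.d, InBox (loK P.L k z) (bondHiK P.L k z κ) x →
      iterBlockOf k (cover P x) = coverAt P k z ∨ iterBlockOf k (cover P x) = coverAt P k (z + e κ) := fun x hx => by
    rw [iterBlockOf_cover hk]
    rcases blockMap_of_inBox_loK hL k z κ hx with h | h
    · exact Or.inl (by rw [h])
    · exact Or.inr (by rw [h])
  rw [tgt_mk_cover, tgt_mk_coverAt]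
  exact ⟨key w hw.1, key (w + e μ) hw.2⟩

variable {𝔸 : Type*} [NormedRing 𝔸] [NormedAlgebra ℂ 𝔸]

/-- Straight-segment sums are `ℂ`-homogeneous. [cite: Balaban1984PropagatorsI, (1.8) p.18] -/
theorem segSum_const_smul {j : ℕ} (a : ℂ) (A : PBond P j → 𝔸) (x : Site P j) (ν : Fin P.d) (n : ℕ) :
    segSum (a • A) x ν n = a • segSum A x ν n := by
  simp only [segSum, Pi.smul_apply, Finset.smul_sum]

/-- `Q_k(a·A) = a·Q_k(A)` for a complex scalar `a` (standing range). [cite: Balaban1984PropagatorsI, (1.18) p.20] -/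
theorem bondAvgIter_const_smul {k : ℕ} (hk : k ≤ P.m + P.K) (a : ℂ) (A : PBond P 0 → 𝔸) (c : PBond P k) :
    bondAvgIter k (a • A) c = a • bondAvgIter k A c := by
  rw [bondAvgIter_eq_blockSum k hk, bondAvgIter_eq_blockSum k hk, smul_comm a]
  congr 1
  rw [Finset.smul_sum]
  exact Finset.sum_congr rfl fun x _ => segSum_const_smul a A x c.dir _

/-- **THE COMB BOX BOUND FROM THE TORUS READ BOUND.**  If `A′ = A♭∘π` on the comb box of `(z, κ)` at level `k` and `‖A♭‖ ≤ s` on the torus read territory of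
`c♭ = ⟨π_k z, κ⟩`, then `‖iηA′‖ ≤ η·s` on every bond of the comb box — the `hB` premise of [Balaban1985Averaging] Prop. 4 localised (row (L1)).
[cite: Balaban1985Averaging, Prop. 4 p.38, p.24; Balaban1985RegularSpaces, (1.42) p.83] -/
theorem norm_iEta_le_of_junction {k : ℕ} (hk : k ≤ P.m + P.K) {η : ℝ} (hη : 0 ≤ η) (Af : PBond P 0 → 𝔸) (A' : Pt P.d → Fin P.d → 𝔸)
    (z : Pt P.d) (κ : Fin P.d) (hjunc : AgreeOn (loK P.L k z) (bondHiK P.L k z κ) A' (fun w μ => Af ⟨cover P w, μ⟩)) {s : ℝ}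
    (hA : ∀ b : PBond P 0,
      (iterBlockOf k b.src = (⟨coverAt P k z, κ⟩ : PBond P k).src ∨ iterBlockOf k b.src = (⟨coverAt P k z, κ⟩ : PBond P k).tgt) →
      (iterBlockOf k b.tgt = (⟨coverAt P k z, κ⟩ : PBond P k).src ∨ iterBlockOf k b.tgt = (⟨coverAt P k z, κ⟩ : PBond P k).tgt) →
        ‖Af b‖ ≤ s) :
    ∀ w μ, BondIn (loK P.L k z) (bondHiK P.L k z κ) w μ → ‖iEta η A' w μ‖ ≤ η * s := by
  intro w μ hw
  obtain ⟨h1, h2⟩ := reads_of_bondIn hk z κ hw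
  simp only [iEta]
  rw [hjunc w μ hw.1 hw.2, norm_smul, norm_mul, Complex.norm_I, one_mul, Complex.norm_real, Real.norm_of_nonneg hη]
  exact mul_le_mul_of_nonneg_left (hA _ h1 h2) hη

end Dictionary

/-! ## §2 The knit: `‖Q_k(1, iηA′)(c)‖ ≤ ‖log U̿^{(k)}(W♭)(c♭)‖ + R₁ + R₂` -/

section Knit

variable {𝔸 : Type*} [NormedRing 𝔸] [NormedAlgebra ℂ 𝔸] [CompleteSpace 𝔸] [NormOneClass 𝔸]

/-- ★★ **THE LINEAR KNIT.**  Fine torus `T` with parameters `P`, top level `k ≤ m + K`, a top `ℤᵈ` bond `(z, κ)` and its torus image `c♭ = ⟨π_k z, κ⟩`.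
Let `A′` (on `ℤᵈ`) agree with `A♭∘π` on the comb box `B^k(c₋) ∪ B^k(c₊)`, let the torus configuration `W♭` equal `e^{iηA♭}` on the read territory of `c♭`,
and let `R₁` bound the comb second-order remainder `Q_k(1, iηA′)(z,κ) − LᵏηQ_k(1)(iηA′)(z,κ)` ([Balaban1985Averaging] (127)/(133)) and `R₂` the torus one
`(−i)·log U̿^{(k)}(e^{iηA♭})(c♭) − ηLᵏ·(Q_kA♭)(c♭)` ([Balaban1985Variational] (156), linearised).  Then
`‖Q_k(1, iηA′)(z,κ)‖ ≤ ‖log U̿^{(k)}(W♭)(c♭)‖ + R₁ + R₂` — because the two linear parts are the same number: `LᵏηQ_k(1)(iηA′)(z,κ) = i·ηLᵏ·(Q_kA♭)(c♭)`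
(✓`P1FlatCoreTopBondDictionary.linCovIter_one_eq_smul_bondAvgIter` after localising with ✓`B9Ineq3137LocalSup.linCovIter_congr`), and `U̿^{(k)}(c♭)` reads
only the read territory (✓`Prop8ChartDoubleBar.dbarIterU_congr_of_agree`).
[cite: Balaban1985RegularSpaces, (1.42) p.83, (1.56) p.86; Balaban1985Averaging, (125)-(127) pp.36-37, p.24; Balaban1985Variational, (152)-(156) pp.301-302] -/
theorem norm_logCovIter_one_le_of_remainders {k : ℕ} (hk : k ≤ P.m + P.K) (η : ℝ)
    (Af : PBond P 0 → 𝔸) (A' : Pt P.d → Fin P.d → 𝔸) (Wf : GaugeField P 0 𝔸ˣ) (z : Pt P.d) (κ : Fin P.d)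
    (hjunc : AgreeOn (loK P.L k z) (bondHiK P.L k z κ) A' (fun w μ => Af ⟨cover P w, μ⟩))
    (hW : ∀ b : PBond P 0,
      (iterBlockOf k b.src = (⟨coverAt P k z, κ⟩ : PBond P k).src ∨ iterBlockOf k b.src = (⟨coverAt P k z, κ⟩ : PBond P k).tgt) →
      (iterBlockOf k b.tgt = (⟨coverAt P k z, κ⟩ : PBond P k).src ∨ iterBlockOf k b.tgt = (⟨coverAt P k z, κ⟩ : PBond P k).tgt) →
        Wf b = expCfg η Af b)
    {R₁ R₂ : ℝ}
    (hrem₁ : ‖logCovIter P.L 1 (iEta η A') k z κ - linCovIter P.L 1 (iEta η A') k z κ‖ ≤ R₁)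
    (hrem₂ : ‖(-Complex.I) • mlog ((dbarIterU k (expCfg η Af) ⟨coverAt P k z, κ⟩ : 𝔸ˣ) : 𝔸)
        - ((η : ℂ) * (P.L : ℂ) ^ k) • bondAvgIter k Af ⟨coverAt P k z, κ⟩‖ ≤ R₂) :
    ‖logCovIter P.L 1 (iEta η A') k z κ‖ ≤ ‖mlog ((dbarIterU k Wf ⟨coverAt P k z, κ⟩ : 𝔸ˣ) : 𝔸)‖ + R₁ + R₂ := by
  have hL : 1 ≤ P.L := P.L_pos
  -- the globally periodic exponent field `B♯ = iη·(A♭∘π)`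
  set Bs : Pt P.d → Fin P.d → 𝔸 := fun w μ => ((Complex.I * (η : ℂ)) • Af) ⟨cover P w, μ⟩ with hBs
  have hagree : AgreeOn (loK P.L k z) (bondHiK P.L k z κ) (iEta η A') Bs := fun w μ hw hwe => by
    simp only [iEta, hBs, Pi.smul_apply]
    rw [hjunc w μ hw hwe]
  have hU : AgreeOn (loK P.L k z) (bondHiK P.L k z κ) (1 : Pt P.d → Fin P.d → 𝔸ˣ) 1 := fun _ _ _ _ => rfl
  have hcongr : linCovIter P.L 1 (iEta η A') k z κ = linCovIter P.L 1 Bs k z κ := linCovIter_congr P.L hL k z κ hU hagree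
  -- a global bound for `B♯` (the torus has finitely many bonds)
  obtain ⟨b₀, hb₀⟩ := Finite.exists_le fun b : PBond P 0 => ‖((Complex.I * (η : ℂ)) • Af) b‖
  have hBs_le : ∀ w μ, ‖Bs w μ‖ ≤ max b₀ 0 := fun w μ => (hb₀ _).trans (le_max_left _ _)
  have hL3 := linCovIter_one_eq_smul_bondAvgIter hk ((Complex.I * (η : ℂ)) • Af) Bs (le_max_right b₀ 0) hBs_le
    (fun _ _ => rfl) z κ
  -- the two linear parts are the same number
  have hlin : linCovIter P.L 1 (iEta η A') k z κ =
      Complex.I • (((η : ℂ) * (P.L : ℂ) ^ k) • bondAvgIter k Af ⟨coverAt P k z, κ⟩) := by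
    rw [hcongr, hL3, bondAvgIter_const_smul hk, smul_smul, ← Complex.coe_smul, smul_smul]
    congr 1
    push_cast
    ring
  -- locality of the double-bar average: `U̿^{(k)}(W♭)(c♭) = U̿^{(k)}(e^{iηA♭})(c♭)`
  have hloc : dbarIterU k Wf ⟨coverAt P k z, κ⟩ = dbarIterU k (expCfg η Af) ⟨coverAt P k z, κ⟩ :=
    dbarIterU_congr_of_agree k hk _ hW
  -- assemble the two triangle inequalities
  have h1 : ‖logCovIter P.L 1 (iEta η A') k z κ‖ ≤ ‖linCovIter P.L 1 (iEta η A') k z κ‖ + R₁ :=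
    (norm_le_insert' _ _).trans (by linarith [hrem₁])
  have h2 : ‖linCovIter P.L 1 (iEta η A') k z κ‖ ≤ ‖mlog ((dbarIterU k Wf ⟨coverAt P k z, κ⟩ : 𝔸ˣ) : 𝔸)‖ + R₂ := by
    rw [hlin, norm_smul, Complex.norm_I, one_mul, hloc]
    calc ‖((η : ℂ) * (P.L : ℂ) ^ k) • bondAvgIter k Af ⟨coverAt P k z, κ⟩‖
        ≤ ‖(-Complex.I) • mlog ((dbarIterU k (expCfg η Af) ⟨coverAt P k z, κ⟩ : 𝔸ˣ) : 𝔸)‖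
            + ‖((η : ℂ) * (P.L : ℂ) ^ k) • bondAvgIter k Af ⟨coverAt P k z, κ⟩
                - (-Complex.I) • mlog ((dbarIterU k (expCfg η Af) ⟨coverAt P k z, κ⟩ : 𝔸ˣ) : 𝔸)‖ := norm_le_insert' _ _
      _ ≤ ‖mlog ((dbarIterU k (expCfg η Af) ⟨coverAt P k z, κ⟩ : 𝔸ˣ) : 𝔸)‖ + R₂ := by
          rw [norm_smul, norm_neg, Complex.norm_I, one_mul, norm_sub_rev]
          linarith [hrem₂]
  linarith [h1, h2]

end Knit

/-! ## §3 (v1.1) The assembled bound at `Matrix n n ℂ`: rows (L1), (L2) by name; the `< 2dLα₁` form under the window -/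

section Assembly

open scoped Matrix.Norms.L2Operator
open B7Prop4Flat (C2 c4)
open Summit.QuantumFields.YangMills.Theorems.P1FlatCoreTopCombRemainderLoc (norm_logCovIter_sub_linCovIter_le_loc)
open Summit.QuantumFields.YangMills.Theorems.Prop8ChartDoubleBar (norm_chartLogAt_sub_smul_bondAvgIter_le_of_reads)

variable {n : Type*} [Fintype n] [DecidableEq n] [Nonempty n]

/-- ★★★ **THE LINEAR ROUTE TO (1.42) AT THE TOP, ASSEMBLED.**  Fine torus with parameters `P` (`2 ≤ L`), top level `1 ≤ k ≤ m + K`, `η > 0`, matrices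
`M_n(ℂ)` in the operator norm.  If the `ℤᵈ` exponent field `A′` agrees with `A♭∘π` on the comb box of the top bond `(z, κ)`, the torus configuration `W♭`
equals `e^{iηA♭}` on the read territory of `c♭ = ⟨π_k z, κ⟩`, and `‖A♭‖ ≤ s` there with `Lᵏηs ≤ c₄(d)` ([Balaban1985Averaging] Prop. 4 window) and
`243200((d+2)L)²·Lᵏηs ≤ 1` (the chart's Cauchy window), then
`‖Q_k(1, iηA′)(z,κ)‖ ≤ ‖log U̿^{(k)}(W♭)(c♭)‖ + (C₂(d) + 64·60800·((d+2)L)²)·(Lᵏηs)²`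
— `norm_logCovIter_one_le_of_remainders` with `R₁` from ✓`norm_logCovIter_sub_linCovIter_le_loc` (its box premise by `norm_iEta_le_of_junction`) and `R₂` from
✓`norm_chartLogAt_sub_smul_bondAvgIter_le_of_reads`.
[cite: Balaban1985RegularSpaces, (1.42) p.83, (1.56) p.86; Balaban1985Averaging, Prop. 4 (134)-(135) pp.38-39; Balaban1985Variational, (152)-(156) pp.301-302] -/
theorem norm_logCovIter_one_le_norm_mlog_dbarIterU (hL : 2 ≤ P.L) {k : ℕ} (hk1 : 1 ≤ k) (hk : k ≤ P.m + P.K) {η : ℝ} (hη : 0 < η)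
    (Af : PBond P 0 → Matrix n n ℂ) (A' : Pt P.d → Fin P.d → Matrix n n ℂ) (Wf : GaugeField P 0 (Matrix n n ℂ)ˣ)
    (z : Pt P.d) (κ : Fin P.d) (hjunc : AgreeOn (loK P.L k z) (bondHiK P.L k z κ) A' (fun w μ => Af ⟨cover P w, μ⟩))
    (hW : ∀ b : PBond P 0,
      (iterBlockOf k b.src = (⟨coverAt P k z, κ⟩ : PBond P k).src ∨ iterBlockOf k b.src = (⟨coverAt P k z, κ⟩ : PBond P k).tgt) →
      (iterBlockOf k b.tgt = (⟨coverAt P k z, κ⟩ : PBond P k).src ∨ iterBlockOf k b.tgt = (⟨coverAt P k z, κ⟩ : PBond P k).tgt) →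
        Wf b = expCfg η Af b)
    {s : ℝ} (hs0 : 0 ≤ s)
    (hA : ∀ b : PBond P 0,
      (iterBlockOf k b.src = (⟨coverAt P k z, κ⟩ : PBond P k).src ∨ iterBlockOf k b.src = (⟨coverAt P k z, κ⟩ : PBond P k).tgt) →
      (iterBlockOf k b.tgt = (⟨coverAt P k z, κ⟩ : PBond P k).src ∨ iterBlockOf k b.tgt = (⟨coverAt P k z, κ⟩ : PBond P k).tgt) →
        ‖Af b‖ ≤ s)
    (hkb : (P.L : ℝ) ^ k * (η * s) ≤ c4 P.d)
    (hbudget : 243200 * (((P.d + 2) * P.L : ℕ) : ℝ) ^ 2 * (P.L : ℝ) ^ k * η * s ≤ 1) :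
    ‖logCovIter P.L 1 (iEta η A') k z κ‖ ≤
      ‖mlog ((dbarIterU k Wf ⟨coverAt P k z, κ⟩ : (Matrix n n ℂ)ˣ) : Matrix n n ℂ)‖ +
        (C2 P.d + 64 * 60800 * (((P.d + 2) * P.L : ℕ) : ℝ) ^ 2) * ((P.L : ℝ) ^ k * η * s) ^ 2 := by
  have hB := norm_iEta_le_of_junction hk hη.le Af A' z κ hjunc hA
  have h1 := (norm_logCovIter_sub_linCovIter_le_loc P.L hL k hk1 z κ (iEta η A') (by positivity : (0 : ℝ) ≤ η * s) hB hkb).1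
  have h2 := norm_chartLogAt_sub_smul_bondAvgIter_le_of_reads η hη hk (⟨coverAt P k z, κ⟩ : PBond P k) Af hs0 hbudget hA
  have h := norm_logCovIter_one_le_of_remainders hk η Af A' Wf z κ hjunc hW h1 h2
  have e : (P.L : ℝ) ^ k * (η * s) = (P.L : ℝ) ^ k * η * s := by ring
  rw [e] at h
  linarith

/-- ★★ **THE SAME IN THE SOCKET LETTERS OF `H42`.**  ✓`B8Prop3GaugeFixedKLevel.hP3_gaugeFixed_of_b9` supplies `‖A′(b)‖ ≤ α₂·(Lʲη)⁻¹` on the socket bonds of level `j`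
(`α₂ = 2Lc⋆ + 8α₄`); at the top level `j = k` this is `s = α₂·(Lᵏη)⁻¹`, `Lᵏηs = α₂`, so the two windows read `α₂ ≤ c₄(d)`, `243200((d+2)L)²α₂ ≤ 1` and the
bound is `‖Q_k(1, iηA′)(z,κ)‖ ≤ ‖log U̿^{(k)}(W♭)(c♭)‖ + (C₂(d) + 64·60800·((d+2)L)²)·α₂²`.
[cite: Balaban1985RegularSpaces, (1.42) p.83, (1.34)-(1.35) p.82; Balaban1985Averaging, Prop. 4 pp.38-39; Balaban1985Variational, (152)-(156) pp.301-302] -/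
theorem norm_logCovIter_one_le_norm_mlog_dbarIterU_of_socket (hL : 2 ≤ P.L) {k : ℕ} (hk1 : 1 ≤ k) (hk : k ≤ P.m + P.K) {η : ℝ} (hη : 0 < η)
    (Af : PBond P 0 → Matrix n n ℂ) (A' : Pt P.d → Fin P.d → Matrix n n ℂ) (Wf : GaugeField P 0 (Matrix n n ℂ)ˣ)
    (z : Pt P.d) (κ : Fin P.d) (hjunc : AgreeOn (loK P.L k z) (bondHiK P.L k z κ) A' (fun w μ => Af ⟨cover P w, μ⟩))
    (hW : ∀ b : PBond P 0,
      (iterBlockOf k b.src = (⟨coverAt P k z, κ⟩ : PBond P k).src ∨ iterBlockOf k b.src = (⟨coverAt P k z, κ⟩ : PBond P k).tgt) →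
      (iterBlockOf k b.tgt = (⟨coverAt P k z, κ⟩ : PBond P k).src ∨ iterBlockOf k b.tgt = (⟨coverAt P k z, κ⟩ : PBond P k).tgt) →
        Wf b = expCfg η Af b)
    {α₂ : ℝ} (hα₂ : 0 ≤ α₂)
    (hA : ∀ b : PBond P 0,
      (iterBlockOf k b.src = (⟨coverAt P k z, κ⟩ : PBond P k).src ∨ iterBlockOf k b.src = (⟨coverAt P k z, κ⟩ : PBond P k).tgt) →
      (iterBlockOf k b.tgt = (⟨coverAt P k z, κ⟩ : PBond P k).src ∨ iterBlockOf k b.tgt = (⟨coverAt P k z, κ⟩ : PBond P k).tgt) →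
        ‖Af b‖ ≤ α₂ * ((P.L : ℝ) ^ k * η)⁻¹)
    (hkb : α₂ ≤ c4 P.d) (hbudget : 243200 * (((P.d + 2) * P.L : ℕ) : ℝ) ^ 2 * α₂ ≤ 1) :
    ‖logCovIter P.L 1 (iEta η A') k z κ‖ ≤
      ‖mlog ((dbarIterU k Wf ⟨coverAt P k z, κ⟩ : (Matrix n n ℂ)ˣ) : Matrix n n ℂ)‖ +
        (C2 P.d + 64 * 60800 * (((P.d + 2) * P.L : ℕ) : ℝ) ^ 2) * α₂ ^ 2 := by
  have hL0 : (0 : ℝ) < (P.L : ℝ) ^ k * η := by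
    have : (0 : ℝ) < P.L := by exact_mod_cast P.L_pos
    positivity
  have e : (P.L : ℝ) ^ k * η * (α₂ * ((P.L : ℝ) ^ k * η)⁻¹) = α₂ := by field_simp
  have hs0 : 0 ≤ α₂ * ((P.L : ℝ) ^ k * η)⁻¹ := mul_nonneg hα₂ (inv_nonneg.mpr hL0.le)
  have hkb' : (P.L : ℝ) ^ k * (η * (α₂ * ((P.L : ℝ) ^ k * η)⁻¹)) ≤ c4 P.d := by rwa [← mul_assoc, e]
  have hbudget' : 243200 * (((P.d + 2) * P.L : ℕ) : ℝ) ^ 2 * (P.L : ℝ) ^ k * η * (α₂ * ((P.L : ℝ) ^ k * η)⁻¹) ≤ 1 := by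
    have h' : 243200 * (((P.d + 2) * P.L : ℕ) : ℝ) ^ 2 * (P.L : ℝ) ^ k * η * (α₂ * ((P.L : ℝ) ^ k * η)⁻¹) =
        243200 * (((P.d + 2) * P.L : ℕ) : ℝ) ^ 2 * ((P.L : ℝ) ^ k * η * (α₂ * ((P.L : ℝ) ^ k * η)⁻¹)) := by ring
    rw [h', e]
    exact hbudget
  have h := norm_logCovIter_one_le_norm_mlog_dbarIterU hL hk1 hk hη Af A' Wf z κ hjunc hW hs0 hA hkb' hbudget'
  rwa [e] at h

/-- ★ **ROW (P3-top) IN `H42`'S SHAPE, UNDER THE DISPLAYED WINDOW.**  With the (o)-bound of row (L4) at the top bond, `‖log U̿^{(k)}(W♭)(c♭)‖ ≤ 2ϱε₁`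
(✓`P1FlatCoreDP1TopBonds.norm_mlog_dbarIterU_chart_le_of_top`, `ϱ = |c♭₋ − y₀|₁`), and the window `2ϱε₁ + (C₂(d) + 64·60800·((d+2)L)²)·α₂² < 2dLα₁`:
`‖Q_k(1, iηA′)(z,κ)‖ < 2dLα₁` — the top clause `j = k` of hypothesis `H42` of ✓`B8Prop3GaugeFixedKLevel.hP3_gaugeFixed_of_b9` at `U₀ = 1`.
[cite: Balaban1985RegularSpaces, Prop. 3 (1.42) p.83; Balaban1985Variational, (156) p.302] -/
theorem logCovIter_top_lt_of_window (hL : 2 ≤ P.L) {k : ℕ} (hk1 : 1 ≤ k) (hk : k ≤ P.m + P.K) {η : ℝ} (hη : 0 < η)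
    (Af : PBond P 0 → Matrix n n ℂ) (A' : Pt P.d → Fin P.d → Matrix n n ℂ) (Wf : GaugeField P 0 (Matrix n n ℂ)ˣ)
    (z : Pt P.d) (κ : Fin P.d) (hjunc : AgreeOn (loK P.L k z) (bondHiK P.L k z κ) A' (fun w μ => Af ⟨cover P w, μ⟩))
    (hW : ∀ b : PBond P 0,
      (iterBlockOf k b.src = (⟨coverAt P k z, κ⟩ : PBond P k).src ∨ iterBlockOf k b.src = (⟨coverAt P k z, κ⟩ : PBond P k).tgt) →
      (iterBlockOf k b.tgt = (⟨coverAt P k z, κ⟩ : PBond P k).src ∨ iterBlockOf k b.tgt = (⟨coverAt P k z, κ⟩ : PBond P k).tgt) →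
        Wf b = expCfg η Af b)
    {α₂ : ℝ} (hα₂ : 0 ≤ α₂)
    (hA : ∀ b : PBond P 0,
      (iterBlockOf k b.src = (⟨coverAt P k z, κ⟩ : PBond P k).src ∨ iterBlockOf k b.src = (⟨coverAt P k z, κ⟩ : PBond P k).tgt) →
      (iterBlockOf k b.tgt = (⟨coverAt P k z, κ⟩ : PBond P k).src ∨ iterBlockOf k b.tgt = (⟨coverAt P k z, κ⟩ : PBond P k).tgt) →
        ‖Af b‖ ≤ α₂ * ((P.L : ℝ) ^ k * η)⁻¹)
    (hkb : α₂ ≤ c4 P.d) (hbudget : 243200 * (((P.d + 2) * P.L : ℕ) : ℝ) ^ 2 * α₂ ≤ 1)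
    {ϱ ε₁ α₁ : ℝ} (htop : ‖mlog ((dbarIterU k Wf ⟨coverAt P k z, κ⟩ : (Matrix n n ℂ)ˣ) : Matrix n n ℂ)‖ ≤ 2 * (ϱ * ε₁))
    (hwin : 2 * (ϱ * ε₁) + (C2 P.d + 64 * 60800 * (((P.d + 2) * P.L : ℕ) : ℝ) ^ 2) * α₂ ^ 2 < 2 * (P.d : ℝ) * P.L * α₁) :
    ‖logCovIter P.L 1 (iEta η A') k z κ‖ < 2 * (P.d : ℝ) * P.L * α₁ := by
  have h := norm_logCovIter_one_le_norm_mlog_dbarIterU_of_socket hL hk1 hk hη Af A' Wf z κ hjunc hW hα₂ hA hkb hbudget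
  linarith

end Assembly

end Summit.QuantumFields.YangMills.Theorems.P1FlatCoreTopLinearKnit

end
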